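import Mathlib
import Summits.Ventures.HodgeRepro.Tier4.Line4.IntegProper
import Summits.Ventures.HodgeRepro.Tier4.Line4.LevelIndicator
import Summits.Ventures.HodgeRepro.Tier4.Line4.ConvProduct

/-!
# Tier4/Line4/ChainInputsFin2 — C-L4-CHAININPUTS-FIN, part 2: the clause `hB1` of `ChainInputs` for a product function
with a BOUNDED archimedean factor and the level indicator `levelDC` as finite factor

Blind re-derivation cell `pub-hodge-repro`, Tier 4 «prove the step» (README §9–§10), seat t4-L1-p1 g5 (prover, LINE L4
chair; the cut (c) of plan-4 g6 S15814 (iii) / S15824).  Tree path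
`lean/Summits/Ventures/HodgeRepro/Tier4/Line4/ChainInputsFin2.lean`.  Mathlib-level; no literature; no `def`.

THE CLAUSE.  `ChainInputs.hB1` (MainTermInstance p708127): `t ↦ χ(t) · innerFull F γ₀ t` is `μ_T`-integrable on the
product domain `T_∞ × DZ_f` (`prodDomain W DZf`), `innerFull F γ₀ t = ∫_{T′(𝔸)} conj χ′(t′) F(t⁻¹ γ₀ t′) dμ_{T′}`.
L2-p1's `integrableOn_chi_mul_innerFull_prodDomain` (IntegProper) proves it for a COMPACTLY SUPPORTED continuous `F`;
the witness of record `F = conv (finf ⊗ ffinMu) (e ⊗ levelInd)` is NOT compactly supported (its archimedean factor is the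
convolution `c₀ · (finf ∗ e)`) but it IS a product function `F g = F_∞(g_∞) · levelDC(g_f)` (MainTermInstance's
`isProductFn_conv'` + LevelIndicator's `convFin_ffinMu_levelInd`) with `F_∞` continuous and BOUNDED (L4-x2's ARCH output).

WHAT IS PROVED (sorry-free, axioms `[propext, Classical.choice, Quot.sound]`): **`integrableOn_chi_mul_innerFull_prodDomain_of_isProductFn_levelDC`**
= `hB1` for ANY `F` with `hprod : IsProductFn W F Finf (levelDC W γ₀ N)`, `Finf` continuous (the bound `‖Finf‖ ≤ C` is
not even needed: on the compact support region continuity suffices), under `[CompactSpace (torusInf W)]`,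
`[CompactSpace (torusInf' W)]`, PROPER `hprop` and ZDOMAIN-EX (iv) `hDZc` on an arbitrary measurable `DZf` — L2-p1's proof
with `tsupport F` replaced by the compact double coset `K(N) γ₀,f K(N)`: the joint integrand `(t, t′) ↦ χ(t) conj χ′(t′)
F(t⁻¹ γ₀ t′)` vanishes unless `(t⁻¹ γ₀ t′)_f ∈ K(N) γ₀,f K(N)`, which confines `(t_f, t′_f)` to `K₁ × K₂`
(`mem_compact_of_hasProperFinOrbit`), the archimedean coordinates ranging over the compact `T_∞ × T′_∞`; continuous on
the compact `split⁻¹(T_∞ × K₁) × split′⁻¹(T′_∞ × K₂)`, hence integrable there, and `0` off it; Fubini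
(`Integrable.integral_prod_left`) gives the outer integrability.  The assembler (L2-p3's `chainInputs_of_pieces`)
instantiates `F := conv …`, `Finf := c₀ · convInf finf e`, `hprod` from `isProductFn_conv'`, `hFinf` from ARCH.

Nothing here says anything about the status of the Hodge conjecture for CM abelian varieties, which is NOT proved
(HC_CM is NOT proved by anyone in this repository).
-/

set_option autoImplicit false
noncomputable section
namespace Summit.Ventures.HodgeRepro.Tier4.Line4
open Summit.Ventures.HodgeRepro.Tier4 Summit.Ventures.HodgeRepro.Tier4.Common Summit.Ventures.HodgeRepro.Tier4.Line1
  MeasureTheory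
open scoped ComplexConjugate Topology Pointwise NNReal

section B1
variable {k : Type} [Field k] [NumberField k] (W : PlaneData k) [MeasurableSpace (GA W)] [BorelSpace (GA W)]
  (R : RTFData W)

/-- **`hB1` for a product function `F = F_∞ ⊗ levelDC`** (`F_∞` continuous; PROPER and ZDOMAIN-EX (iv) as binders):
`t ↦ χ(t) · innerFull F γ₀ t` is `μ_T`-integrable on the product domain `T_∞ × DZ_f`. -/
theorem integrableOn_chi_mul_innerFull_prodDomain_of_isProductFn_levelDC
    [CompactSpace (torusInf W)] [CompactSpace (torusInf' W)]
    (hR : R.IsHaar) (hc : Continuous R.chi) (_hu : ∀ a, ‖R.chi a‖ = 1) (hc' : Continuous R.chi')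
    (_hu' : ∀ a, ‖R.chi' a‖ = 1) (γ₀ : rationalPoints W) {N : ℕ} (hN : N ≠ 0)
    (F Finf : GA W → ℂ) (hprod : IsProductFn W F Finf (levelDC W (γ₀ : GA W) N)) (hFinf : Continuous Finf)
    (hprop : HasProperFinOrbit W (γ₀ : GA W))
    (DZf : Set (torusFin W)) (hDZf : MeasurableSet DZf)
    (hDZc : ∀ C : Set (torusFin W), IsCompact C → IsCompact (closure (DZf ∩ (C * (ZfIn W : Set (torusFin W)))))) :
    IntegrableOn (fun t : torusT W => R.chi t * innerFull W R F (γ₀ : GA W) t) (prodDomain W DZf) R.μT := by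
  haveI : R.μT.IsHaarMeasure := hR.1
  haveI : R.μT'.IsHaarMeasure := hR.2.1
  haveI : T2Space (GA W) := t2Space_GA W
  haveI := secondCountable_GA W
  haveI : LocallyCompactSpace (torusT W) := locallyCompact_torusT W
  haveI : LocallyCompactSpace (torusT' W) := locallyCompactSpace_torusT' W
  haveI : SecondCountableTopology (torusT W) := secondCountable_torusT W
  haveI : SecondCountableTopology (torusT' W) :=
    TopologicalSpace.Subtype.secondCountableTopology (torusT' W : Set (GA W))
  haveI : BorelSpace (torusT W) := Subtype.borelSpace _
  haveI : BorelSpace (torusT' W) := Subtype.borelSpace _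
  haveI : BorelSpace (torusFin W) := Subtype.borelSpace _
  haveI : BorelSpace (torusT W × torusT' W) := Prod.borelSpace
  haveI : IsLocallyFiniteMeasure R.μT := isLocallyFiniteMeasure_of_isFiniteMeasureOnCompacts
  haveI : IsLocallyFiniteMeasure R.μT' := isLocallyFiniteMeasure_of_isFiniteMeasureOnCompacts
  haveI : SigmaFinite R.μT := sigmaFinite_of_locallyFinite
  haveI : SigmaFinite R.μT' := sigmaFinite_of_locallyFinite
  -- `F` is continuous
  have hFc : Continuous F := by
    have hFeq : F = fun g => Finf (GA.ofInfPart W g) * levelDC W (γ₀ : GA W) N (GA.ofFinPart W g) := funext hprod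
    rw [hFeq]
    exact (hFinf.comp (continuous_ofInfPart W)).mul ((continuous_levelDC W _ N hN).comp (continuous_ofFinPart W))
  -- the compact sets
  obtain ⟨K₁, K₂, hK₁, hK₂, hmem⟩ := mem_compact_of_hasProperFinOrbit W (γ₀ : GA W) hprop DZf hDZc
    (levelDoubleCoset W N (GA.ofFinPart W (γ₀ : GA W))) (isCompact_levelDoubleCoset W hN _)
  have hK : IsCompact ((torusSplit W).symm '' (Set.univ ×ˢ K₁)) :=
    (isCompact_univ.prod hK₁).image (torusSplit W).symm.continuous
  have hK' : IsCompact ((torusSplit' W).symm '' (Set.univ ×ˢ K₂)) :=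
    (isCompact_univ.prod hK₂).image (torusSplit' W).symm.continuous
  have hP : MeasurableSet (prodDomain W DZf) := by
    rw [prodDomain_eq_preimage]
    exact hDZf.preimage (continuous_snd.comp (torusSplit W).continuous).measurable
  -- the joint integrand
  have hfc : Continuous (fun q : torusT W × torusT' W => R.chi q.1 * innerFn W R F (γ₀ : GA W) q.1 q.2) := by
    show Continuous fun q : torusT W × torusT' W =>
      R.chi q.1 * (conj (R.chi' q.2) * F ((q.1 : GA W)⁻¹ * (γ₀ : GA W) * (q.2 : GA W)))
    have h1 : Continuous fun q : torusT W × torusT' W => (q.1 : GA W) :=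
      continuous_subtype_val.comp continuous_fst
    have h2 : Continuous fun q : torusT W × torusT' W => (q.2 : GA W) :=
      continuous_subtype_val.comp continuous_snd
    exact (hc.comp continuous_fst).mul ((Complex.continuous_conj.comp (hc'.comp continuous_snd)).mul
      (hFc.comp ((h1.inv.mul continuous_const).mul h2)))
  have hfK : IntegrableOn (fun q : torusT W × torusT' W => R.chi q.1 * innerFn W R F (γ₀ : GA W) q.1 q.2)
      (((torusSplit W).symm '' (Set.univ ×ˢ K₁)) ×ˢ ((torusSplit' W).symm '' (Set.univ ×ˢ K₂)))
      (R.μT.prod R.μT') :=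
    hfc.continuousOn.integrableOn_compact (hK.prod hK')
  have hfP : IntegrableOn (fun q : torusT W × torusT' W => R.chi q.1 * innerFn W R F (γ₀ : GA W) q.1 q.2)
      (prodDomain W DZf ×ˢ Set.univ) (R.μT.prod R.μT') := by
    refine hfK.of_forall_sdiff_eq_zero (hP.prod MeasurableSet.univ) ?_
    intro q hq
    by_contra hne
    have hF0 : F ((q.1 : GA W)⁻¹ * (γ₀ : GA W) * (q.2 : GA W)) ≠ 0 := by
      intro h0
      apply hne
      show R.chi q.1 * (R.chi'conj q.2 * F ((q.1 : GA W)⁻¹ * (γ₀ : GA W) * (q.2 : GA W))) = 0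
      rw [h0, mul_zero, mul_zero]
    -- the finite factor does not vanish, so the finite part lies in the double coset
    have hlev : levelDC W (γ₀ : GA W) N (GA.ofFinPart W ((q.1 : GA W)⁻¹ * (γ₀ : GA W) * (q.2 : GA W))) ≠ 0 := by
      intro h0
      apply hF0
      rw [hprod, h0, mul_zero]
    have hC : GA.ofFinPart W ((q.1 : GA W)⁻¹ * (γ₀ : GA W) * (q.2 : GA W)) ∈
        levelDoubleCoset W N (GA.ofFinPart W (γ₀ : GA W)) :=
      mem_levelDoubleCoset_of_levelDC_ne_zero W (γ₀ : GA W) N (ofFinPart_mem_finitePart W _) hlev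
    have hrw : GA.ofFinPart W ((q.1 : GA W)⁻¹ * (γ₀ : GA W) * (q.2 : GA W)) =
        (((finTf W q.1 : torusT W) : GA W))⁻¹ * GA.ofFinPart W (γ₀ : GA W) * ((finTf' W q.2 : torusT' W) : GA W) := by
      rw [ofFinPart_mul, ofFinPart_mul, ofFinPart_inv]
      rfl
    have hb : finTf W q.1 ∈ DZf := by
      have h := hq.1.1
      rw [prodDomain_eq_preimage] at h
      exact h
    have hK12 : finTf W q.1 ∈ K₁ ∧ finTf' W q.2 ∈ K₂ := by
      refine hmem (finTf W q.1, finTf' W q.2) hb ?_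
      show (((finTf W q.1 : torusT W) : GA W))⁻¹ * GA.ofFinPart W (γ₀ : GA W) *
        ((finTf' W q.2 : torusT' W) : GA W) ∈ levelDoubleCoset W N (GA.ofFinPart W (γ₀ : GA W))
      rw [← hrw]
      exact hC
    refine hq.2 ⟨?_, ?_⟩
    · exact ⟨torusSplit W q.1, ⟨Set.mem_univ _, hK12.1⟩, (torusSplit W).symm_apply_apply q.1⟩
    · exact ⟨torusSplit' W q.2, ⟨Set.mem_univ _, hK12.2⟩, (torusSplit' W).symm_apply_apply q.2⟩
  rw [IntegrableOn, ← Measure.restrict_prod_eq_prod_univ] at hfP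
  refine hfP.integral_prod_left.congr (Filter.Eventually.of_forall fun t => ?_)
  show ∫ t' : torusT' W, R.chi t * innerFn W R F (γ₀ : GA W) t t' ∂(R.μT') = R.chi t * innerFull W R F (γ₀ : GA W) t
  unfold innerFull
  rw [integral_const_mul]

end B1

end Summit.Ventures.HodgeRepro.Tier4.Line4

end
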